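import Mathlib.Data.Nat.Choose.Bounds
import Mathlib.Data.Nat.Choose.Factorization
import Mathlib.Data.Int.CardIntervalMod
import Mathlib.Algebra.Polynomial.Degree.SmallDegree
import Literature.NumberTheory.DiophantineApproximation.PolylogShiftHermitePade
import HarnessLib

/-!
# Type-I Hermite–Padé forms for the shifted polylogarithms (`m` shifts, `s ≤ w`) — arithmetic of the bricks

Topic `Literature/NumberTheory/DiophantineApproximation`. Continuation of
`PolylogShiftHermitePade.lean` (the vocabulary `stepBinomM`, `resM`, `kernelM` of the `m`-shift
generalisation of the parity programme `PolylogTwoPointHermitePade*.lean`, after David–Hirata-Kohno–Kawashima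
2020, Thm 2.1). In the variable `t = mu` the `m`-shift kernel
`K^{(m,w)}_n(u) = m^{2wn} (u − wn + 1)_{wn}/(mu+1)_{n+1}^w` is the product of the `w` BRICKS

  `m^{2n} (t/m − (s+1)n + 1)_n / (t+1)_{n+1}`   (`s < w`),

rational functions of `t` with the simple poles `t = −1, …, −(n+1)` and a numerator of degree `n`, hence
(Lagrange division at the nodes `−1, …, −(n+1)`, `BallRivoal.lagrange_div`) of the shape
`∑_{μ ≤ n} A_μ/(t+μ+1)`. This file proves that the residues `A_μ` are the INTEGERS
`resM m n s μ = (−1)^{n+μ} C(n,μ) E_m(μ+1+msn, n)` and bounds them: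

* `factorial_dvd_pow_mul_prod_arith`: `n! ∣ m^n q (q+m) ⋯ (q+(n−1)m)` — Legendre's formula on an
  arithmetic progression of step `m` (for `p ∣ m` the factor `m^n` suffices; for `p ∤ m` every block of
  `p^i` consecutive terms contains a multiple of `p^i`), the one new arithmetic input of the `m`-shift
  programme (for `m = 2` it is the integrality of `C(2n, n)`-type numbers, `ParityPade.stepTwoBinom`);
* `stepBinomM_mul_factorial`: hence the closed form `E_m(q, n) · n! = m^n ∏_{i<n} (q + m i)` of the
  `m`-step binomial numbers (`stepBinomM` is defined by natural division);
* `stepBinomM_le`: `E_m(q, n) ≤ m^{2n} C(q+n, n)`;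
* `brickM_eq_brickEval`: `m^{2n} (t/m − (s+1)n + 1)_n/(t+1)_{n+1} = ∑_{μ ≤ n} (resM m n s μ)/(t+μ+1)` for
  `t ∉ {−1, …, −(n+1)}` (the numerator at `t = −μ−1` is `(−m)^n ∏_{i<n} (μ + 1 + msn + m(n−1−i))
  = (−1)^n n! E_m(μ+1+msn, n)` after the reflection `i ↦ n−1−i`);
* `sum_abs_resM_le`: `∑_{μ ≤ n} |resM m n s μ| ≤ m^{2n} 2^{(ms+3)n+1}`.

Everything is PROVED; no definitions, no named facts. The product formula for the kernel and its partial
fraction expansion are in `PolylogShiftHermitePadeExpansion.lean`.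

References: S. David, N. Hirata-Kohno, M. Kawashima, *Can polylogarithms at algebraic points be linearly
independent?*, Moscow J. Comb. Number Th. 9 (2020) 389–406, Thm 2.1 [DavidHirataKohnoKawashima2020];
T. Rivoal, C. R. Acad. Sci. Paris 331 (2000), §2 proof of Lemme 5 (the brick mechanism) [Rivoal2000].
-/

open Finset Polynomial

namespace Literature.NumberTheory.DiophantineApproximation

namespace ShiftPade

open Literature.NumberTheory.Transcendental

/-! ### Legendre's formula on an arithmetic progression -/

/-- In an arithmetic progression `q, q + m, q + 2m, …` of step `m` coprime to `r ≥ 1`, at least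
`n / r` of any `n` consecutive terms are divisible by `r`. [folklore] -/
theorem shiftPade_div_le_card_filter_dvd (m q n r : ℕ) (hr : 0 < r) (hmr : Nat.Coprime m r) :
    n / r ≤ #{j ∈ range n | r ∣ q + m * j} := by
  obtain ⟨c, -, hc⟩ := Nat.exists_mul_mod_eq_of_coprime (r - q % r) hmr hr.ne'
  have hdvd : r ∣ q + m * c := by
    rw [Nat.dvd_iff_mod_eq_zero, Nat.add_mod, hc]
    rcases Nat.eq_zero_or_pos (q % r) with h0 | hpos
    · rw [h0, Nat.sub_zero, Nat.mod_self, Nat.zero_mod]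
    · rw [Nat.mod_eq_of_lt (Nat.sub_lt hr hpos), Nat.add_sub_cancel' (Nat.mod_lt q hr).le,
        Nat.mod_self]
  calc n / r ≤ n.count (· ≡ c [MOD r]) := by
        rw [Nat.count_modEq_card n hr c]
        exact Nat.le_add_right _ _
    _ = #{j ∈ range n | j ≡ c [MOD r]} := Nat.count_eq_card_filter_range _ n
    _ ≤ #{j ∈ range n | r ∣ q + m * j} := by
        refine card_le_card fun j hj => ?_
        rw [mem_filter] at hj ⊢
        refine ⟨hj.1, ?_⟩
        have h : q + m * j ≡ q + m * c [MOD r] := (hj.2.mul_left m).add_left q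
        exact (Nat.modEq_zero_iff_dvd.1 ((h.trans (Nat.modEq_zero_iff_dvd.2 hdvd))))

/-- The number of exponents `1 ≤ i < b` with `p^i ∣ x` (`x ≠ 0`, `p` prime) is at most `v_p(x)`.
[folklore] -/
theorem shiftPade_card_filter_pow_dvd_le (p x b : ℕ) (hp : p.Prime) (hx : x ≠ 0) :
    #{i ∈ Ico 1 b | p ^ i ∣ x} ≤ x.factorization p := by
  calc #{i ∈ Ico 1 b | p ^ i ∣ x} ≤ #(Icc 1 (x.factorization p)) := by
        refine card_le_card fun i hi => ?_
        rw [mem_filter, mem_Ico] at hi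
        rw [mem_Icc]
        exact ⟨hi.1.1, (hp.pow_dvd_iff_le_factorization hx).1 hi.2⟩
    _ = x.factorization p := by rw [Nat.card_Icc, Nat.add_sub_cancel]

/-- **Legendre's formula on an arithmetic progression of step `m`**: `n! ∣ m^n · q (q+m) ⋯ (q+(n−1)m)`,
i.e. the `m`-step binomial numbers `E_m(q, n) = m^n ∏_{i<n} (q + m i)/n!` (the Taylor coefficients of
`(1 − m² x)^{−q/m}`) are integers. For a prime `p ∣ m`, `v_p(n!) ≤ n ≤ v_p(m^n)`; for `p ∤ m`,
`v_p(n!) = ∑_{i ≥ 1} ⌊n/p^i⌋` (Legendre) and each block of `p^i` consecutive terms of the progression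
contains a multiple of `p^i` (`m` is a unit mod `p^i`), so `⌊n/p^i⌋ ≤ #{j < n : p^i ∣ q + m j}` and
`∑_i #{j < n : p^i ∣ q + m j} = ∑_{j<n} #{i : p^i ∣ q + m j} ≤ ∑_{j<n} v_p(q + m j)`. [folklore] -/
theorem factorial_dvd_pow_mul_prod_arith (m q n : ℕ) (hm : 1 ≤ m) :
    n.factorial ∣ m ^ n * ∏ i ∈ Finset.range n, (q + m * i) := by
  rcases Nat.eq_zero_or_pos n with rfl | hn
  · simp
  rcases Nat.eq_zero_or_pos q with rfl | hq
  · rw [prod_eq_zero (mem_range.2 hn) (by simp), mul_zero]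
    exact dvd_zero _
  have hP : ∏ i ∈ range n, (q + m * i) ≠ 0 := prod_ne_zero_iff.2 fun i _ => by omega
  have hmn : m ^ n ≠ 0 := pow_ne_zero _ (by omega)
  refine (Nat.factorization_prime_le_iff_dvd (Nat.factorial_ne_zero n) (mul_ne_zero hmn hP)).1
    fun p hp => ?_
  rw [Nat.factorization_mul hmn hP, Finsupp.add_apply, Nat.factorization_pow, Finsupp.smul_apply,
    smul_eq_mul, Nat.factorization_prod_apply fun i _ => by omega]
  by_cases hpm : p ∣ m
  · calc (n.factorial).factorization p ≤ n :=
          (Nat.factorization_factorial_le_div_pred hp n).trans (Nat.div_le_self _ _)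
      _ ≤ n * m.factorization p :=
          Nat.le_mul_of_pos_right n (hp.factorization_pos_of_dvd (by omega) hpm)
      _ ≤ _ := Nat.le_add_right _ _
  · have hcop : Nat.Coprime m p := ((Nat.Prime.coprime_iff_not_dvd hp).2 hpm).symm
    calc (n.factorial).factorization p = ∑ i ∈ Ico 1 (Nat.log p n + 1), n / p ^ i :=
          Nat.factorization_factorial hp (Nat.lt_succ_self _)
      _ ≤ ∑ i ∈ Ico 1 (Nat.log p n + 1), #{j ∈ range n | p ^ i ∣ q + m * j} :=
          sum_le_sum fun i _ =>
            shiftPade_div_le_card_filter_dvd m q n (p ^ i) (pow_pos hp.pos i) (hcop.pow_right i)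
      _ = ∑ j ∈ range n, #{i ∈ Ico 1 (Nat.log p n + 1) | p ^ i ∣ q + m * j} := by
          simp only [card_filter]
          exact sum_comm
      _ ≤ ∑ j ∈ range n, (q + m * j).factorization p :=
          sum_le_sum fun j _ => shiftPade_card_filter_pow_dvd_le p _ _ hp (by omega)
      _ ≤ _ := Nat.le_add_left _ _

/-- **Closed form of the `m`-step binomial numbers**: `E_m(q, n) · n! = m^n ∏_{i<n} (q + m i)`
(the natural division in `stepBinomM` is exact, by `factorial_dvd_pow_mul_prod_arith`). [folklore] -/
theorem stepBinomM_mul_factorial (m q n : ℕ) (hm : 1 ≤ m) :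
    ((stepBinomM m q n : ℕ) : ℚ) * (n.factorial : ℚ) =
      (m : ℚ) ^ n * ∏ i ∈ Finset.range n, ((q : ℚ) + m * i) := by
  have h : stepBinomM m q n * n.factorial = m ^ n * ∏ i ∈ range n, (q + m * i) :=
    Nat.div_mul_cancel (factorial_dvd_pow_mul_prod_arith m q n hm)
  exact_mod_cast h

/-- `E_m(q, n) ≤ m^{2n} C(q+n, n)`: `E_m(q, n) · n! = m^n ∏_{i<n} (q + m i) ≤ m^{2n} ∏_{i<n} (q + i)
= m^{2n} n! C(q+n−1, n) ≤ m^{2n} n! C(q+n, n)`. [folklore] -/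
theorem stepBinomM_le (m q n : ℕ) (hm : 1 ≤ m) : stepBinomM m q n ≤ m ^ (2 * n) * (q + n).choose n := by
  unfold stepBinomM
  refine Nat.div_le_of_le_mul ?_
  calc m ^ n * ∏ i ∈ range n, (q + m * i) ≤ m ^ n * ∏ i ∈ range n, (m * (q + i)) := by
        refine Nat.mul_le_mul_left _ (prod_le_prod' fun i _ => ?_)
        rw [mul_add]
        exact Nat.add_le_add_right (Nat.le_mul_of_pos_left q hm) _
    _ = m ^ (2 * n) * (n.factorial * (q + n - 1).choose n) := by
        rw [prod_mul_distrib, prod_const, card_range, ← Nat.ascFactorial_eq_prod_range,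
          Nat.ascFactorial_eq_factorial_mul_choose', two_mul, pow_add, mul_assoc]
    _ ≤ m ^ (2 * n) * (n.factorial * (q + n).choose n) :=
        Nat.mul_le_mul_left _ (Nat.mul_le_mul_left _ (Nat.choose_le_choose n (Nat.sub_le _ _)))
    _ = n.factorial * (m ^ (2 * n) * (q + n).choose n) := by ring

/-! ### The `m`-shift brick and its residues -/

/-- The numerator of the `m`-shift brick `s` at the node `t = −μ−1`:
`m^{2n} ((−μ−1)/m − (s+1)n + 1)_n = (−m)^n ∏_{i<n} (μ + 1 + msn + m(n − 1 − i)) = (−1)^n n! E_m(μ+1+msn, n)`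
(reflect `i ↦ n − 1 − i` and use `stepBinomM_mul_factorial`). [folklore] -/
private theorem pow_mul_poch_node (m n s μ : ℕ) (hm : 1 ≤ m) :
    (m : ℚ) ^ (2 * n) * BallRivoal.poch ((-(μ : ℚ) - 1) / m - ((s : ℚ) + 1) * n + 1) n =
      (-1) ^ n * (((stepBinomM m (μ + 1 + m * s * n) n : ℕ) : ℚ) * n.factorial) := by
  have hm' : (m : ℚ) ≠ 0 := by exact_mod_cast (by omega : m ≠ 0)
  have hrefl : ∏ i ∈ range n, (((μ + 1 + m * s * n : ℕ) : ℚ) + (m : ℚ) * (i : ℚ)) =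
      ∏ i ∈ range n, (((μ + 1 + m * s * n : ℕ) : ℚ) + (m : ℚ) * ((n - 1 - i : ℕ) : ℚ)) :=
    (prod_range_reflect (fun j => ((μ + 1 + m * s * n : ℕ) : ℚ) + (m : ℚ) * (j : ℚ)) n).symm
  rw [stepBinomM_mul_factorial m _ n hm, hrefl, BallRivoal.poch, ← mul_assoc, ← mul_pow, pow_mul,
    show ((m : ℚ) ^ 2) ^ n = ∏ _i ∈ range n, (m : ℚ) ^ 2 by rw [prod_const, card_range],
    show ((-1 : ℚ) * m) ^ n = ∏ _i ∈ range n, ((-1 : ℚ) * m) by rw [prod_const, card_range],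
    ← prod_mul_distrib, ← prod_mul_distrib]
  refine prod_congr rfl fun i hi => ?_
  have hi' : i < n := mem_range.1 hi
  rw [Nat.cast_sub (by omega : i ≤ n - 1), Nat.cast_sub (by omega : 1 ≤ n)]
  push_cast
  field_simp
  ring

/-- **The `m`-shift brick is a Ball–Rivoal brick with integer residues**: for `t ∉ {−1, …, −(n+1)}`,
`m^{2n} (t/m − (s+1)n + 1)_n / (t+1)_{n+1} = ∑_{μ ≤ n} (resM m n s μ)/(t + μ + 1)` with
`resM m n s μ = (−1)^{n+μ} C(n,μ) E_m(μ+1+msn, n)` — Lagrange division (`BallRivoal.lagrange_div`) of the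
degree-`n` numerator `m^{2n} ∏_{i<n} (t/m − (s+1)n + 1 + i)` at the nodes `−1, …, −(n+1)`, whose values
there are `(−1)^n n! E_m(μ+1+msn, n)`; the `m`-shift analogue of Rivoal's `F_l` (`BallRivoal.F_eq_brickEval`)
and of the parity brick (`ParityPade.brick_eq_brickEval`, `m = 2`). [cite: DavidHirataKohnoKawashima2020, Thm 2.1] -/
theorem brickM_eq_brickEval (m n s : ℕ) (hm : 1 ≤ m) (t : ℚ) (ht : ∀ μ, μ ≤ n → t + μ + 1 ≠ 0) :
    (m : ℚ) ^ (2 * n) * BallRivoal.poch (t / m - (s + 1) * n + 1) n / BallRivoal.poch (t + 1) (n + 1) =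
      BallRivoal.brickEval n (resM m n s) t := by
  set P : ℚ[X] := C ((m : ℚ) ^ (2 * n)) *
    ∏ i ∈ range n, (C (1 / (m : ℚ)) * X + C (1 - ((s : ℚ) + 1) * n + i)) with hP
  have hPeval : ∀ x : ℚ, P.eval x = (m : ℚ) ^ (2 * n) * BallRivoal.poch (x / m - (s + 1) * n + 1) n := by
    intro x
    rw [hP, eval_mul, eval_C, eval_prod, BallRivoal.poch]
    congr 1
    refine prod_congr rfl fun i _ => ?_
    rw [eval_add, eval_mul, eval_C, eval_X, eval_C]
    ring
  have hdeg : P.degree < ((n + 1 : ℕ) : WithBot ℕ) := by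
    have h : P.natDegree ≤ n := by
      rw [hP]
      refine (natDegree_C_mul_le _ _).trans ((natDegree_prod_le _ _).trans ?_)
      refine (sum_le_sum (fun (i : ℕ) _ =>
        (natDegree_linear_le : (C (1 / (m : ℚ)) * X + C (1 - ((s : ℚ) + 1) * n + i)).natDegree ≤ 1))).trans
        ?_
      simp
    exact (degree_le_of_natDegree_le h).trans_lt (WithBot.coe_lt_coe.2 (Nat.lt_succ_self n))
  have h := BallRivoal.lagrange_div n P hdeg t ht
  rw [hPeval] at h
  rw [h, BallRivoal.brickEval]
  refine sum_congr rfl fun μ hμ => ?_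
  have hμ' : μ ≤ n := Nat.lt_succ_iff.1 (mem_range.1 hμ)
  rw [hPeval]
  congr 1
  rw [pow_mul_poch_node m n s μ hm, resM]
  have hf : ((μ.factorial : ℚ) * (n - μ).factorial) ≠ 0 := by positivity
  push_cast
  rw [Nat.cast_choose ℚ hμ']
  field_simp
  ring

/-! ### Bounds for the residues -/

/-- `∑_{μ ≤ n} |resM m n s μ| ≤ m^{2n} 2^{(ms+3)n+1}`: `|resM m n s μ| = C(n,μ) E_m(μ+1+msn, n) ≤
C(n,μ) m^{2n} C(μ+1+msn+n, n) ≤ C(n,μ) m^{2n} 2^{(ms+2)n+1}` (`μ ≤ n`) and `∑_μ C(n,μ) = 2^n`. [folklore] -/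
theorem sum_abs_resM_le (m n s : ℕ) (hm : 1 ≤ m) :
    ∑ μ ∈ Finset.range (n + 1), |(resM m n s μ : ℚ)| ≤ (m : ℚ) ^ (2 * n) * 2 ^ ((m * s + 3) * n + 1) := by
  have h : ∀ μ ∈ range (n + 1),
      |(resM m n s μ : ℚ)| ≤ (n.choose μ : ℚ) * ((m : ℚ) ^ (2 * n) * (2 : ℚ) ^ ((m * s + 2) * n + 1)) := by
    intro μ hμ
    have hμ' : μ ≤ n := Nat.lt_succ_iff.1 (mem_range.1 hμ)
    have h1 : stepBinomM m (μ + 1 + m * s * n) n ≤ m ^ (2 * n) * 2 ^ ((m * s + 2) * n + 1) := by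
      calc stepBinomM m (μ + 1 + m * s * n) n
          ≤ m ^ (2 * n) * (μ + 1 + m * s * n + n).choose n := stepBinomM_le _ _ _ hm
        _ ≤ m ^ (2 * n) * 2 ^ (μ + 1 + m * s * n + n) :=
          Nat.mul_le_mul_left _ (Nat.choose_le_two_pow _ _)
        _ ≤ m ^ (2 * n) * 2 ^ (n + 1 + m * s * n + n) :=
          Nat.mul_le_mul_left _ (Nat.pow_le_pow_right (by norm_num) (by omega))
        _ = m ^ (2 * n) * 2 ^ ((m * s + 2) * n + 1) := by
          congr 2
          ring
    have h1' : ((stepBinomM m (μ + 1 + m * s * n) n : ℕ) : ℚ) ≤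
        (m : ℚ) ^ (2 * n) * (2 : ℚ) ^ ((m * s + 2) * n + 1) := by
      exact_mod_cast h1
    rw [resM]
    push_cast
    rw [abs_mul, abs_mul, abs_pow, abs_neg, abs_one, one_pow, one_mul, Nat.abs_cast, Nat.abs_cast]
    exact mul_le_mul_of_nonneg_left h1' (Nat.cast_nonneg _)
  refine (sum_le_sum h).trans ?_
  rw [← sum_mul, ← Nat.cast_sum, Nat.sum_range_choose]
  push_cast
  rw [mul_left_comm, ← pow_add]
  exact le_of_eq (by congr 2; ring)

end ShiftPade

end Literature.NumberTheory.DiophantineApproximation
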